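import Mathlib
import Summits.Ventures.PercRepro2.LocRows
import Summits.Ventures.PercRepro2.SwRow

/-!
# The hull swap: the off-hull parts of row (SW) / 2′DOM cancel, the row is its hull-essential part
(blind cell PercRepro2, night-4 g3, 2026-08-24T08:3xZ; proofs/NIGHT4-SW.md §3)

On `Q = tgtU ends l h {S ∣ o ∈ S} = {h ∉ H_l, o ∈ R_side(l)}` let `offHull ζ` be the configuration
with every edge touching the hull `H_l = C_R(l) ∪ C_B(l)` deleted; `cluster ends (offHull ζ) h` is
the red cluster of `h` outside the hull, `cluster ends (offHull (blue ζ)) h` its blue cluster outside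
the hull.  The **hull swap** `hullSwap ζ` complements the colouring on the edges NOT touching the
hull and keeps it on the edges touching the hull:

* it keeps both clusters of `l` (`cluster_hullSwap`, `cluster_blue_hullSwap`), so it is an
  involution of `Q` (`hullSwap_hullSwap`, `hullSwap_mem_tgtU_iff`);
* it turns the red outside cluster of `h` into the blue outside cluster of `h`
  (`offHull_blue_hullSwap`);
* hence for every family `𝓥`: `#{ζ ∈ Q : C_R(h)(outside) ∈ 𝓥} = #{ζ ∈ Q : C_B(h)(outside) ∈ 𝓥}`
  (`card_offHull_red_eq_blue`).

Consequently the counting inequality of row 2′DOM at the principal up-set (equivalently row (SW),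
`sw_iff_card_le`) is EQUIVALENT to its hull-essential part (`card_le_iff_essential`,
`sw_iff_essential`): for every up-set `𝓥`,

  `#{ζ ∈ Q : C_R(h) ∈ 𝓥, C_R(h)(outside) ∉ 𝓥} ≤ #{ζ ∈ Q : C_B(h) ∈ 𝓥, C_B(h)(outside) ∉ 𝓥}`

— the configurations in which the red cluster of `h` reaches `𝓥` only through the BLUE side of `l`
against those in which the blue cluster of `h` reaches `𝓥` only through the RED side of `l`
(a red path from `h` never meets `C_R(l)`, a blue one never meets `C_B(l)`).  This is the exact
open content of the weight-free base; the Reimer-covered part of `SwReimerPart.lean` is the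
`∈ 𝓥`-outside part, which this file shows cancels exactly (it needs no Reimer).
-/

namespace Summit.Ventures.PercRepro2

namespace HullSwap

open Hull LocRows

variable {V : Type*} {E : Type*} [Fintype E] [DecidableEq E]

open scoped Classical

variable (ends : E → Sym2 V)

/-- The configuration with every edge touching the hull of `l` deleted. -/
noncomputable def offHull (l : V) (ζ : Config E) : Config E := delConfig ends (hull ends ζ l) ζ

/-- The hull swap: complement the colouring off the edges touching the hull of `l`. -/
noncomputable def hullSwap (l : V) (ζ : Config E) : Config E :=
  fun e => if e ∈ touches ends (hull ends ζ l) then ζ e else !ζ e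

omit [Fintype E] [DecidableEq E] in
/-- The hull swap on an edge touching the hull. -/
lemma hullSwap_apply_of_mem {l : V} {ζ : Config E} {e : E} (h : e ∈ touches ends (hull ends ζ l)) :
    hullSwap ends l ζ e = ζ e := by simp [hullSwap, h]

omit [Fintype E] [DecidableEq E] in
/-- The hull swap on an edge not touching the hull. -/
lemma hullSwap_apply_of_notMem {l : V} {ζ : Config E} {e : E}
    (h : e ∉ touches ends (hull ends ζ l)) : hullSwap ends l ζ e = !ζ e := by simp [hullSwap, h]

omit [Fintype E] [DecidableEq E] in
/-- Two configurations agreeing on the edges touching a set `P ⊇ C(l)` have the same cluster of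
`l` (both inclusions, via the closure lemma). -/
lemma cluster_eq_of_eqOn_touches {ω ω' : Config E} {l : V} {P : Set V}
    (hP : cluster ends ω l ⊆ P) (hP' : cluster ends ω' l ⊆ P)
    (heq : ∀ e ∈ touches ends P, ω' e = ω e) : cluster ends ω' l = cluster ends ω l := by
  ext u
  constructor
  · intro hu
    rw [mem_cluster] at hu
    refine mem_of_conn_of_closed (ends := ends) (ω := ω') (S := cluster ends ω l) ?_
      (mem_cluster_self _ _ _) hu
    intro x hx y hxy
    obtain ⟨_, e, he, hends⟩ := exists_edge_of_adj hxy
    have het : e ∈ touches ends P := ⟨x, hP hx, y, hends⟩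
    rw [heq e het] at he
    exact mem_cluster_of_edge hx he hends
  · intro hu
    rw [mem_cluster] at hu
    refine mem_of_conn_of_closed (ends := ends) (ω := ω) (S := cluster ends ω' l) ?_
      (mem_cluster_self _ _ _) hu
    intro x hx y hxy
    obtain ⟨_, e, he, hends⟩ := exists_edge_of_adj hxy
    have het : e ∈ touches ends P := ⟨x, hP' hx, y, hends⟩
    rw [← heq e het] at he
    exact mem_cluster_of_edge hx he hends

omit [Fintype E] [DecidableEq E] in
/-- The hull swap keeps the red cluster of `l`. -/
lemma cluster_hullSwap (l : V) (ζ : Config E) :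
    cluster ends (hullSwap ends l ζ) l = cluster ends ζ l := by
  -- first the inclusion `⊆`, then use it to place the swapped cluster inside the hull
  have h1 : cluster ends (hullSwap ends l ζ) l ⊆ cluster ends ζ l := by
    intro u hu
    rw [mem_cluster] at hu
    refine mem_of_conn_of_closed (ends := ends) (ω := hullSwap ends l ζ) (S := cluster ends ζ l) ?_
      (mem_cluster_self _ _ _) hu
    intro x hx y hxy
    obtain ⟨_, e, he, hends⟩ := exists_edge_of_adj hxy
    have het : e ∈ touches ends (hull ends ζ l) := ⟨x, Or.inl hx, y, hends⟩
    rw [hullSwap_apply_of_mem ends het] at he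
    exact mem_cluster_of_edge hx he hends
  exact cluster_eq_of_eqOn_touches ends (P := hull ends ζ l) (fun _ hx => Or.inl hx)
    (fun _ hx => Or.inl (h1 hx)) (fun e he => hullSwap_apply_of_mem ends he)

omit [Fintype E] [DecidableEq E] in
/-- The blue colouring of the hull swap is the hull swap of the blue colouring. -/
lemma blue_hullSwap (l : V) (ζ : Config E) :
    blue (hullSwap ends l ζ) = hullSwap ends l (blue ζ) := by
  funext e
  by_cases he : e ∈ touches ends (hull ends ζ l)
  · have he' : e ∈ touches ends (hull ends (blue ζ) l) := by rwa [hull_blue]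
    rw [blue_apply, hullSwap_apply_of_mem ends he, hullSwap_apply_of_mem ends he', blue_apply]
  · have he' : e ∉ touches ends (hull ends (blue ζ) l) := by rwa [hull_blue]
    rw [blue_apply, hullSwap_apply_of_notMem ends he, hullSwap_apply_of_notMem ends he', blue_apply]

omit [Fintype E] [DecidableEq E] in
/-- The hull swap keeps the blue cluster of `l`. -/
lemma cluster_blue_hullSwap (l : V) (ζ : Config E) :
    cluster ends (blue (hullSwap ends l ζ)) l = cluster ends (blue ζ) l := by
  rw [blue_hullSwap, cluster_hullSwap]

omit [Fintype E] [DecidableEq E] in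
/-- The hull swap keeps the hull. -/
lemma hull_hullSwap (l : V) (ζ : Config E) : hull ends (hullSwap ends l ζ) l = hull ends ζ l := by
  simp only [hull, cluster_hullSwap, cluster_blue_hullSwap]

omit [Fintype E] [DecidableEq E] in
/-- The hull swap is an involution. -/
lemma hullSwap_hullSwap (l : V) (ζ : Config E) :
    hullSwap ends l (hullSwap ends l ζ) = ζ := by
  funext e
  by_cases he : e ∈ touches ends (hull ends ζ l)
  · have he' : e ∈ touches ends (hull ends (hullSwap ends l ζ) l) := by rwa [hull_hullSwap]
    rw [hullSwap_apply_of_mem ends he', hullSwap_apply_of_mem ends he]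
  · have he' : e ∉ touches ends (hull ends (hullSwap ends l ζ) l) := by rwa [hull_hullSwap]
    rw [hullSwap_apply_of_notMem ends he', hullSwap_apply_of_notMem ends he, Bool.not_not]

/-- The hull swap preserves `Q`. -/
lemma hullSwap_mem_tgtU_iff (l h o : V) (ζ : Config E) :
    hullSwap ends l ζ ∈ tgtU ends l h {S : Set V | o ∈ S} ↔ ζ ∈ tgtU ends l h {S : Set V | o ∈ S} := by
  simp only [tgtU, Finset.mem_filter, Finset.mem_univ, true_and, Set.mem_setOf_eq, hull_hullSwap,
    cluster_hullSwap, cluster_blue_hullSwap]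

omit [Fintype E] [DecidableEq E] in
/-- Outside the hull, the blue colouring of the hull swap is the red colouring:
`offHull (blue (hullSwap ζ)) = offHull ζ`. -/
lemma offHull_blue_hullSwap (l : V) (ζ : Config E) :
    offHull ends l (blue (hullSwap ends l ζ)) = offHull ends l ζ := by
  funext e
  have hh : hull ends (blue (hullSwap ends l ζ)) l = hull ends ζ l := by
    rw [hull_blue, hull_hullSwap]
  unfold offHull
  rw [hh]
  by_cases he : e ∈ touches ends (hull ends ζ l)
  · rw [delConfig_apply_of_mem he, delConfig_apply_of_mem he]
  · rw [delConfig_apply_of_notMem he, delConfig_apply_of_notMem he, blue_apply,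
      hullSwap_apply_of_notMem ends he, Bool.not_not]

/-- **The outside parts cancel**: for every family `𝓥`,
`#{ζ ∈ Q : C_R(h)(outside) ∈ 𝓥} = #{ζ ∈ Q : C_B(h)(outside) ∈ 𝓥}`. -/
theorem card_offHull_red_eq_blue (l h o : V) (𝓥 : Set (Set V)) :
    ((tgtU ends l h {S : Set V | o ∈ S}).filter fun ζ =>
        cluster ends (offHull ends l ζ) h ∈ 𝓥).card =
      ((tgtU ends l h {S : Set V | o ∈ S}).filter fun ζ =>
        cluster ends (offHull ends l (blue ζ)) h ∈ 𝓥).card := by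
  refine Finset.card_bij' (fun ζ _ => hullSwap ends l ζ) (fun ζ _ => hullSwap ends l ζ) ?_ ?_ ?_ ?_
  · intro ζ hζ
    rw [Finset.mem_filter] at hζ ⊢
    refine ⟨(hullSwap_mem_tgtU_iff ends l h o ζ).2 hζ.1, ?_⟩
    rw [offHull_blue_hullSwap]; exact hζ.2
  · intro ζ hζ
    rw [Finset.mem_filter] at hζ ⊢
    refine ⟨(hullSwap_mem_tgtU_iff ends l h o ζ).2 hζ.1, ?_⟩
    have e := offHull_blue_hullSwap ends l (hullSwap ends l ζ)
    rw [hullSwap_hullSwap] at e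
    rw [← e]; exact hζ.2
  · intro ζ _; exact hullSwap_hullSwap ends l ζ
  · intro ζ _; exact hullSwap_hullSwap ends l ζ

omit [Fintype E] [DecidableEq E] in
/-- The outside cluster lies inside the cluster. -/
lemma cluster_offHull_subset (l h : V) (ζ : Config E) :
    cluster ends (offHull ends l ζ) h ⊆ cluster ends ζ h :=
  cluster_mono (fun e => by
    unfold offHull
    by_cases he : e ∈ touches ends (hull ends ζ l)
    · rw [delConfig_apply_of_mem he]; exact Bool.false_le _
    · rw [delConfig_apply_of_notMem he]) h

/-- A count over `Q ∩ {C ∈ 𝓥}` splits into the outside part and the hull-essential part. -/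
lemma card_split (l h o : V) {𝓥 : Set (Set V)} (h𝓥 : IsUpperSet 𝓥) (ω : Config E → Config E)
    (hω : ∀ ζ, cluster ends (offHull ends l (ω ζ)) h ⊆ cluster ends (ω ζ) h) :
    ((tgtU ends l h {S : Set V | o ∈ S}).filter fun ζ => cluster ends (ω ζ) h ∈ 𝓥).card =
      ((tgtU ends l h {S : Set V | o ∈ S}).filter fun ζ =>
          cluster ends (offHull ends l (ω ζ)) h ∈ 𝓥).card +
        ((tgtU ends l h {S : Set V | o ∈ S}).filter fun ζ =>
          cluster ends (ω ζ) h ∈ 𝓥 ∧ cluster ends (offHull ends l (ω ζ)) h ∉ 𝓥).card := by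
  rw [← Finset.card_filter_add_card_filter_not
    (p := fun ζ => cluster ends (offHull ends l (ω ζ)) h ∈ 𝓥)
    (s := (tgtU ends l h {S : Set V | o ∈ S}).filter fun ζ => cluster ends (ω ζ) h ∈ 𝓥)]
  congr 1
  · congr 1; ext ζ
    simp only [Finset.mem_filter]
    constructor
    · rintro ⟨⟨h1, _⟩, h3⟩; exact ⟨h1, h3⟩
    · rintro ⟨h1, h3⟩; exact ⟨⟨h1, h𝓥 (hω ζ) h3⟩, h3⟩
  · congr 1; ext ζ
    simp only [Finset.mem_filter, and_assoc]

/-- **The reduction**: the counting inequality of row 2′DOM at the principal up-set holds for `𝓥`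
iff its hull-essential part holds. -/
theorem card_le_iff_essential (l h o : V) {𝓥 : Set (Set V)} (h𝓥 : IsUpperSet 𝓥) :
    (((srcU ends l h {S : Set V | o ∈ S}).filter fun ζ => cluster ends (blue ζ) h ∈ 𝓥)).card ≤
        (((tgtU ends l h {S : Set V | o ∈ S}).filter fun ζ => cluster ends (blue ζ) h ∈ 𝓥)).card ↔
      ((tgtU ends l h {S : Set V | o ∈ S}).filter fun ζ =>
          cluster ends ζ h ∈ 𝓥 ∧ cluster ends (offHull ends l ζ) h ∉ 𝓥).card ≤
        ((tgtU ends l h {S : Set V | o ∈ S}).filter fun ζ =>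
          cluster ends (blue ζ) h ∈ 𝓥 ∧ cluster ends (offHull ends l (blue ζ)) h ∉ 𝓥).card := by
  -- the source count is the red count on `Q` through the colour swap
  have hsrc : (((srcU ends l h {S : Set V | o ∈ S}).filter fun ζ =>
      cluster ends (blue ζ) h ∈ 𝓥)).card =
      (((tgtU ends l h {S : Set V | o ∈ S}).filter fun ζ => cluster ends ζ h ∈ 𝓥)).card := by
    refine Finset.card_bij' (fun ζ _ => blue ζ) (fun ζ _ => blue ζ) ?_ ?_ ?_ ?_
    · intro ζ hζ
      rw [Finset.mem_filter] at hζ ⊢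
      exact ⟨(blue_mem_tgtU_iff ends).2 hζ.1, hζ.2⟩
    · intro ζ hζ
      rw [Finset.mem_filter] at hζ ⊢
      refine ⟨(blue_mem_srcU_iff ends).2 hζ.1, ?_⟩
      simpa [blue_blue] using hζ.2
    · intro ζ _; exact blue_blue ζ
    · intro ζ _; exact blue_blue ζ
  rw [hsrc, card_split ends l h o h𝓥 (fun ζ => ζ) (fun ζ => cluster_offHull_subset ends l h ζ),
    card_split ends l h o h𝓥 (fun ζ => blue ζ) (fun ζ => cluster_offHull_subset ends l h (blue ζ)),
    card_offHull_red_eq_blue ends l h o 𝓥]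
  omega

/-- **Row (SW) is exactly its hull-essential part**: `Sw` holds iff for every up-set `𝓥`
`#{ζ ∈ Q : C_R(h) ∈ 𝓥, C_R(h)(outside) ∉ 𝓥} ≤ #{ζ ∈ Q : C_B(h) ∈ 𝓥, C_B(h)(outside) ∉ 𝓥}`. -/
theorem sw_iff_essential (l h o : V) :
    Sw ends l h o ↔ ∀ 𝓥 : Set (Set V), IsUpperSet 𝓥 →
      ((tgtU ends l h {S : Set V | o ∈ S}).filter fun ζ =>
          cluster ends ζ h ∈ 𝓥 ∧ cluster ends (offHull ends l ζ) h ∉ 𝓥).card ≤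
        ((tgtU ends l h {S : Set V | o ∈ S}).filter fun ζ =>
          cluster ends (blue ζ) h ∈ 𝓥 ∧ cluster ends (offHull ends l (blue ζ)) h ∉ 𝓥).card := by
  rw [sw_iff_card_le]
  constructor
  · intro hc 𝓥 h𝓥
    exact (card_le_iff_essential ends l h o h𝓥).1 (hc 𝓥 h𝓥)
  · intro hc 𝓥 h𝓥
    exact (card_le_iff_essential ends l h o h𝓥).2 (hc 𝓥 h𝓥)

end HullSwap

end Summit.Ventures.PercRepro2
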